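import Mathlib
import Summits.Ventures.HodgeRepro2.T5CubeTypes
import Summits.Ventures.HodgeRepro2.T5DatumCMField

/-!
# T6N2WeakApprox — weak approximation WITH MAGNITUDES on a CM frame (owner t6-p5)

Support for T6N2ToyIso (the N2 datum with an explicit isometry): on a CM frame `τ = (τ₁, τ₂, τ₃)`
of the CM field `K` there is a totally real `u ∈ K` with `τ₁(u) ∈ (0, 1)`, `τ₂(u) < 0`, `τ₃(u) > 1`
(`exists_u`) — from Mathlib's weak approximation at the infinite places
(`NumberField.InfinitePlace.denseRange_algebraMap_pi`: the image of `K` is dense in `∏_w K_w`),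
applied to the open box of tuples within `1/2` of the integer targets `(1, −2, 4)` at the places
`mk τ₁`, `mk τ₂`, `mk τ₃` (`exists_approx`; distinct places by `mk_ne_of_isCMFrame`), and then
`u := (x + x̄)/4`. p3's `exists_totallyReal_signs` gives SIGNS only; the explicit isometry needs the
magnitudes. No display, no new datum.

README §8(d): uses an L-value-free non-vanishing device: NO (TIER5 §N2, a pre-02:16Z line of
record — N2 asserts no non-vanishing — continued).
-/

namespace Summit.Ventures.HodgeRepro2.T6.N2WeakApprox

open Summit.Ventures.HodgeRepro2
open Summit.Ventures.HodgeRepro2.T5CubeTypes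
open Summit.Ventures.HodgeRepro2.T5DatumCMField
open NumberField
open NumberField.ComplexEmbedding (conjugate)

variable {K : Type*} [Field K] [NumberField K] [NumberField.IsCMField K]

/-! ### Weak approximation with magnitudes -/

omit [NumberField K] [NumberField.IsCMField K] in
/-- The real part of an embedding is insensitive to conjugation of the embedding. -/
theorem re_embedding_mk (φ : K →+* ℂ) (x : K) :
    ((InfinitePlace.mk φ).embedding x).re = (φ x).re := by
  rcases InfinitePlace.embedding_mk_eq φ with h | h
  · rw [h]
  · rw [h, re_conjugate]

omit [NumberField K] [NumberField.IsCMField K] in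
/-- Two embeddings of a CM frame, or an embedding and the conjugate of another, define distinct
infinite places. -/
theorem mk_ne_of_isCMFrame {τ : Fin 3 → (K →+* ℂ)} (hfr : IsCMFrame τ) {ν μ : Fin 3} (h : ν ≠ μ) :
    InfinitePlace.mk (τ ν) ≠ InfinitePlace.mk (τ μ) := by
  intro heq
  rcases InfinitePlace.mk_eq_iff.mp heq with h1 | h1
  · exact h (hfr.injective h1)
  · exact hfr.ne_conjugate μ ν h1.symm

omit [NumberField.IsCMField K] in
/-- WEAK APPROXIMATION WITH MAGNITUDES (Mathlib's `denseRange_algebraMap_pi`): an element `x` of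
`K` with `Re τ₁(x) ≈ 1`, `Re τ₂(x) ≈ −2`, `Re τ₃(x) ≈ 4` within `1/2`. -/
theorem exists_approx {τ : Fin 3 → (K →+* ℂ)} (hfr : IsCMFrame τ) :
    ∃ x : K, |(τ 0 x).re - 1| < 1 / 2 ∧ |(τ 1 x).re + 2| < 1 / 2 ∧ |(τ 2 x).re - 4| < 1 / 2 := by
  classical
  -- the integer targets, indexed by the infinite places
  let q : InfinitePlace K → K := fun w =>
    if w = InfinitePlace.mk (τ 0) then (1 : K)
    else if w = InfinitePlace.mk (τ 1) then (-2 : K)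
    else if w = InfinitePlace.mk (τ 2) then (4 : K) else 0
  -- the open set of tuples within `1/2` of the targets, place by place
  let s : Set ((w : InfinitePlace K) → WithAbs w.1) :=
    Set.pi Set.univ fun w => Metric.ball ((WithAbs.equiv w.1).symm (q w)) (1 / 2)
  have hopen : IsOpen s := isOpen_set_pi Set.finite_univ fun _ _ => Metric.isOpen_ball
  have hne : s.Nonempty :=
    ⟨fun w => (WithAbs.equiv w.1).symm (q w), fun w _ => Metric.mem_ball_self (by norm_num)⟩
  obtain ⟨x, hx⟩ := (InfinitePlace.denseRange_algebraMap_pi K).exists_mem_open hopen hne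
  -- at each place `w`, `‖w.embedding x − w.embedding (q w)‖ < 1/2`
  have key : ∀ w : InfinitePlace K, ‖w.embedding x - w.embedding (q w)‖ < 1 / 2 := by
    intro w
    have h := hx w (Set.mem_univ w)
    rw [Metric.mem_ball, dist_eq_norm] at h
    have e1 : (algebraMap K ((w : InfinitePlace K) → WithAbs w.1) x) w =
        (WithAbs.equiv w.1).symm x := rfl
    rw [e1, ← map_sub] at h
    have e2 : ‖(WithAbs.equiv w.1).symm (x - q w)‖ = w (x - q w) := rfl
    rw [e2, ← InfinitePlace.norm_embedding_eq, map_sub] at h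
    exact h
  -- read the real parts
  have re_lt : ∀ w : InfinitePlace K, |(w.embedding x).re - (w.embedding (q w)).re| < 1 / 2 := by
    intro w
    have h := key w
    calc |(w.embedding x).re - (w.embedding (q w)).re|
        = |(w.embedding x - w.embedding (q w)).re| := by rw [Complex.sub_re]
      _ ≤ ‖w.embedding x - w.embedding (q w)‖ := Complex.abs_re_le_norm _
      _ < 1 / 2 := h
  have h10 : InfinitePlace.mk (τ 1) ≠ InfinitePlace.mk (τ 0) := mk_ne_of_isCMFrame hfr (by decide)
  have h20 : InfinitePlace.mk (τ 2) ≠ InfinitePlace.mk (τ 0) := mk_ne_of_isCMFrame hfr (by decide)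
  have h21 : InfinitePlace.mk (τ 2) ≠ InfinitePlace.mk (τ 1) := mk_ne_of_isCMFrame hfr (by decide)
  refine ⟨x, ?_, ?_, ?_⟩
  · have h := re_lt (InfinitePlace.mk (τ 0))
    have hq : q (InfinitePlace.mk (τ 0)) = 1 := if_pos rfl
    rw [re_embedding_mk, re_embedding_mk, hq, map_one, Complex.one_re] at h
    exact h
  · have h := re_lt (InfinitePlace.mk (τ 1))
    have hq : q (InfinitePlace.mk (τ 1)) = -2 := by
      simp [q, h10]
    rw [re_embedding_mk, re_embedding_mk, hq, map_neg, map_ofNat, Complex.neg_re] at h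
    simpa [sub_neg_eq_add] using h
  · have h := re_lt (InfinitePlace.mk (τ 2))
    have hq : q (InfinitePlace.mk (τ 2)) = 4 := by
      simp [q, h20, h21]
    rw [re_embedding_mk, re_embedding_mk, hq, map_ofNat] at h
    simpa using h

/-- A totally real `u` with `τ₁(u) ∈ (0, 1)`, `τ₂(u) < 0`, `τ₃(u) > 1`: `u := (x + x̄)/4` for the
`x` of `exists_approx`. -/
theorem exists_u {τ : Fin 3 → (K →+* ℂ)} (hfr : IsCMFrame τ) :
    ∃ u : K, star u = u ∧ 0 < (τ 0 u).re ∧ (τ 0 u).re < 1 ∧ (τ 1 u).re < 0 ∧ 1 < (τ 2 u).re := by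
  obtain ⟨x, h0, h1, h2⟩ := exists_approx hfr
  refine ⟨(x + star x) / 4, ?_, ?_, ?_, ?_, ?_⟩
  · rw [star_div₀, star_add, star_star, add_comm]
    simp
  all_goals
    rw [map_div₀, map_add, embedding_star, map_ofNat]
    rw [abs_lt] at *
    simp only [Complex.div_re, Complex.add_re, Complex.conj_re]
    norm_num
    linarith [h0.1, h0.2, h1.1, h1.2, h2.1, h2.2]

end Summit.Ventures.HodgeRepro2.T6.N2WeakApprox
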